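import Mathlib
import Summits.HodgeConjecture.FermatCycles.HodgeFermatTwistedMomentB

/-!
# LEMMA E at the real odd characters: Legendre symbols of a CM type — THEOREM (Σμ, Legendre) (`HodgeFermat/MuLegendre.lean`; HF-G31b)

Tree copy of the module `HodgeFermat/MuLegendre.lean` of the sibling cell's standalone package
`run/shared/lean/pub/pub-hodgefermat/lean/HodgeFermat/` (256 lines, sha256 `2979b08ee8290a73…`), source lines 37–256 (all: the
Legendre character `leg`, `moment_leg_odd` / `moment_leg_ne_zero` — `S_p = Σ_{0<s<p} (s/p)·s` is odd, hence non-zero, for `p ≡ 3 (mod 4)` —,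
the weight `E`, **`E_sum_eq_of_sameType`** — THEOREM (Σμ, Legendre): at `m = 3p`, `p ≡ 3 (mod 4)` prime, `p ≠ 3`, for two zero-sum
triples with entries prime to `p` and the same CM type `E_p(a) + E_p(b) + E_p(c) = E_p(a′) + E_p(b′) + E_p(c′)`, hypothesis-free —, the
corollaries `legendre_third_eq`, `legendre_Z1_Z3` (`p ≡ 11 (mod 12)`), `legendre_total_eq` (`p ≡ 7 (mod 12)`), the kernel instances
`sameType_33a/33b/21a` and four `example`s) — pub-hodgefermat `CERT.md` l.966, GATE HF-G31b; cell record
`check/MuLegendre_standalone.lean` sha256 `23d4fbe9633a1fb9…` rc 0, axioms [propext, Classical.choice, Quot.sound]; controls MG–MI rc 1.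
Filed by cell `pub-hfermat`, seat prover-1 gen-5, on the COORDINATOR KEEPER RULING of 2026-08-25 (gem sweep H1: take the
off-gate kernel theorem `thmFstar` through the gate; every form of THEOREM F* is on-gate since 2026-08-25/26, gen-0/2/3/4), as
successor work of the same verbatim-port kind: the instance module of GATE HF-G31b, whose algebraic half `TwistedMoment.lean` this
unit landed with THEOREM F* (`HodgeFermatTwistedMomentA/B.lean`, gen-0).
Deviations from the source module, exhaustively: the `import` lines (`…HodgeFermatTwistedMomentB` for `import HodgeFermat.TwistedMoment`;
it carries `LemmaN` and `ChiThree`); this docstring (replacing the module docstring, quoted below); one-line docstrings added (gate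
lint) to the eleven undocumented lemmas `leg_isChar`, `leg_mul_self`, `leg_one`, `leg_eq_or`, `sum_units_eq_sum_range`, `sum_range_odd`,
`moment_leg_ne_zero`, `mue_leg`, `jacobiSym_three_of_mod_twelve_eleven`, `jacobiSym_three_of_mod_twelve_seven`,
`coprime_three_mul_of_prime`.  Every other line — in particular every declaration's statement and proof — is byte-identical to the
source (l.37–256).  Trust base: no hypotheses beyond the displayed binders, no `sorry`; `decide` only in the three source instances
`sameType_33a/33b/21a` (`Fin`-enumerations at levels 33, 21) and `norm_num [jacobiSym…]` in the `example`s;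
axioms = [propext, Classical.choice, Quot.sound].
HONEST FRAMING: explicit algebraic cycles for specific Hodge classes on Fermat/Delsarte varieties; residual open instances
listed; no claim on general Hodge.  (This file is arithmetic of CM types / finite combinatorics of the sibling's KR-free
programme; it claims nothing about cycles.)

The docstring of `HodgeFermat/MuLegendre.lean` (l.3–35), verbatim:

## LEMMA E at the real odd characters: Legendre symbols of a CM type (build hodge-fermat, generation 31, HF-G31b)

The μ-part of LEMMA E (`tables/DPRIME-THEOREM.md` §6, `m₀ = 3`) at the REAL odd characters `ψ = (·/p)`, `p ≡ 3 (mod 4)`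
prime, `p ≠ 3`, level `m = 3p` — the first μ-type instance of LEMMA E in the kernel, and the first kernel statement about
a CM-type coincidence that reads the LEGENDRE SYMBOLS of the entries.  The algebra is `TwistedMoment.lean` (canonical
μ-identity `muw_eq` ∘ `mu_identity`); the non-vanishing of the moment is ELEMENTARY here: `S_p = Σ_{0<s<p} (s/p)·s` is
ODD [`moment_leg_odd`: `(s/p)·s ≡ s (mod 2)` and `Σ_{s<p} s = p(p−1)/2` is odd for `p ≡ 3 (mod 4)`], and the mass
`Σ (s/p)` vanishes [`(−1/p) = −1`, `leg_neg_one`, `mass_eq_zero_of_odd`].  (Classically `S_p = −p·h(−p)`; not used.)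

THEOREM (Σμ, Legendre) [`E_sum_eq_of_sameType`].  Let `p ≠ 3` be prime, `p ≡ 3 (mod 4)`, `m = 3p`; let `T = (a, b, c)`,
`T′ = (a′, b′, c′)` have zero sums mod `m`, all six entries prime to `p`, and the same CM type (`SameType`, the model of
`LemmaN.lean`).  Then `E_p(a) + E_p(b) + E_p(c) = E_p(a′) + E_p(b′) + E_p(c′)` with the weight (E0) of DPRIME §6:
`E_p(x) = (1 − (3/p))·(x/p)` for `3 ∤ x`, `E_p(x) = 2·((x/3)/p)` for `3 ∣ x` [`E`].

COROLLARIES.  (i) `p ≡ 11 (mod 12)` (`(3/p) = 1`, [`jacobiSym_three_of_mod_twelve_eleven`]; unit entries weigh `0`):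
two Z1-at-3 triples `(3y, u, v) ∼ (3y′, u′, v′)` of the same type have `(y/p) = (y′/p)` [`legendre_third_eq`]; a Z1 and a
Z3 triple `(3y, u, v) ∼ (3a′, 3b′, 3c′)` have `(y/p) = (a′/p) + (b′/p) + (c′/p)` [`legendre_Z1_Z3`].
(ii) `p ≡ 7 (mod 12)` (`(3/p) = −1` [`jacobiSym_three_of_mod_twelve_seven`]; these are exactly the prime levels `3p` where
`χ₃ × 1` is BAD and `ChiThree.lean` is silent, e.g. `21, 57, 93`): the TOTAL `Σ_{x ∈ T} (red(x)/p)`, `red(x) = x/3` or `x`,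
is a type invariant [`legendre_total_eq`].  Kernel instances at `33` [(9, 1, 23) ∼ (3, 9, 21): `1 = 1 + 1 − 1`;
(30, 1, 2) ∼ (21, 2, 10): `(10/11) = (7/11)`] and at `21` [the exceptional (U, Z1) coincidence (1, 1, 19) ∼ (1, 3, 17) of
COROLLARY M passes: `2 = 2`], the coincidences certified by `decide` [`sameType_of_fin`], the symbols by `norm_num`.
Planted controls (generation 31, letters MG–MI, each rc 1): `legendre_third_eq` at `p ≡ 3 (mod 4)` is FALSE at `21`
[(3, 1, 17) ∼ (9, 1, 11): `(1/7) = 1 ≠ (3/7) = −1`]; THEOREM (Σμ) without `p ≡ 3 (mod 4)` is FALSE at `15`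
[(1, 2, 12) ∼ (1, 6, 8): `2 ≠ −2`] and `39`; `legendre_total_eq` at `p ≡ 3 (mod 4)` is FALSE at `33`
[(1, 2, 30) ∼ (2, 10, 21): `−1 ≠ −3`].  Numerical cross-read: `code/gen31/mu_legendre_scan.py`,
`results/gen31/local/mu_legendre_scan_131.txt` (all 3024 same-type pairs at the levels `3p`, `p ≡ 3 (mod 4)` prime, `7 ≤ p ≤ 131`:
0 violations; the control rows `p ≡ 1 (mod 4)` violate the E-identity 1704 times).

LIGHT module: imports `TwistedMoment`; no `sorry`; `decide` only on the three 33/21 instances; axioms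
[propext, Classical.choice, Quot.sound].
-/

set_option autoImplicit false

namespace HodgeFermat.KRFree.MuLegendre

open Finset HodgeFermat.KRFree.LemmaN HodgeFermat.KRFree.TwistedMoment
open HodgeFermat.KRFree.ChiThree (units coprime_mod_iff sameType_of_fin)
open scoped NumberTheorySymbols

/-! ## The Legendre character as a bare function -/

/-- `x ↦ (x / p)` (Jacobi symbol of Mathlib; the Legendre symbol for `p` prime) -/
def leg (p : ℕ) (x : ℕ) : ℤ := J((x : ℤ) | p)

/-- `leg p` is a character mod `p` in the sense of `TwistedMoment.IsChar` (periodic, multiplicative) -/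
lemma leg_isChar (p : ℕ) : IsChar p (leg p) where
  periodic x := by unfold leg; rw [Int.natCast_emod, ← jacobiSym.mod_left]
  mul x y := by unfold leg; push_cast; exact jacobiSym.mul_left _ _ _

/-- `(x/p)² = 1` for `x` prime to `p` -/
lemma leg_mul_self {p x : ℕ} (hx : Nat.Coprime x p) : leg p x * leg p x = 1 := by
  unfold leg; rw [← sq]; exact jacobiSym.sq_one (by rw [Int.gcd_natCast_natCast]; exact hx)

/-- `(1/p) = 1` -/
lemma leg_one (p : ℕ) : leg p 1 = 1 := by
  unfold leg; rw [Nat.cast_one]; exact jacobiSym.one_left p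

/-- `(x/p) = ±1` for `x` prime to `p` -/
lemma leg_eq_or {p x : ℕ} (hx : Nat.Coprime x p) : leg p x = 1 ∨ leg p x = -1 :=
  jacobiSym.eq_one_or_neg_one (by rw [Int.gcd_natCast_natCast]; exact hx)

/-- `(−1 / p) = −1` for `p ≡ 3 (mod 4)`: the Legendre character is odd -/
lemma leg_neg_one {p : ℕ} (hp4 : p % 4 = 3) : leg p (p - 1) = -1 := by
  have hp1 : 1 ≤ p := by omega
  unfold leg
  have e : J(((p - 1 : ℕ) : ℤ) | p) = J(-1 | p) := by
    apply jacobiSym.mod_left'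
    rw [Nat.cast_sub hp1, Nat.cast_one, show (p : ℤ) - 1 = -1 + (p : ℤ) * 1 by ring, Int.add_mul_emod_self_left]
  rw [e, jacobiSym.at_neg_one (Nat.odd_iff.mpr (by omega)), ZMod.χ₄_nat_three_mod_four hp4]

/-! ## `S_p = Σ_{0<s<p} (s/p)·s` is odd for `p ≡ 3 (mod 4)` -/

/-- `Σ_{u unit mod p} u = Σ_{u < p} u` (as integers) for `p` prime -/
lemma sum_units_eq_sum_range {p : ℕ} (hp : p.Prime) :
    ∑ u ∈ units p, (u : ℤ) = ((∑ u ∈ range p, u : ℕ) : ℤ) := by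
  unfold units
  rw [Finset.sum_filter, Nat.cast_sum]
  refine Finset.sum_congr rfl (fun u hu => ?_)
  rw [mem_range] at hu
  by_cases h0 : u = 0
  · subst h0; simp
  · rw [if_pos]
    exact Nat.Coprime.symm ((Nat.Prime.coprime_iff_not_dvd hp).mpr
      (fun h => h0 (Nat.eq_zero_of_dvd_of_lt h hu)))

/-- `Σ_{u < p} u` is odd for `p ≡ 3 (mod 4)` -/
lemma sum_range_odd {p : ℕ} (hp4 : p % 4 = 3) : (∑ u ∈ range p, u) % 2 = 1 := by
  obtain ⟨k, rfl⟩ : ∃ k, p = 4 * k + 3 := ⟨p / 4, by omega⟩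
  have h2 := Finset.sum_range_id_mul_two (4 * k + 3)
  rw [show 4 * k + 3 - 1 = 4 * k + 2 by omega,
    show (4 * k + 3) * (4 * k + 2) = (2 * (4 * k * k + 5 * k + 1) + 1) * 2 by ring] at h2
  have h3 := Nat.eq_of_mul_eq_mul_right (by norm_num : 0 < 2) h2
  omega

/-- `S_p(·/p)` is odd, in particular non-zero -/
theorem moment_leg_odd {p : ℕ} (hp : p.Prime) (hp4 : p % 4 = 3) : moment p (leg p) % 2 = 1 := by
  have hd : (2 : ℤ) ∣ moment p (leg p) - ∑ u ∈ units p, (u : ℤ) := by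
    unfold moment
    rw [← Finset.sum_sub_distrib]
    apply Finset.dvd_sum
    intro u hu
    simp only [units, mem_filter, mem_range] at hu
    rcases leg_eq_or hu.2 with h | h
    · rw [h]; exact ⟨0, by ring⟩
    · rw [h]; exact ⟨-(u : ℤ), by ring⟩
  rw [sum_units_eq_sum_range hp] at hd
  have ho := sum_range_odd hp4
  omega

/-- hence `S_p ≠ 0` for `p ≡ 3 (mod 4)` -/
theorem moment_leg_ne_zero {p : ℕ} (hp : p.Prime) (hp4 : p % 4 = 3) : moment p (leg p) ≠ 0 := by
  have h := moment_leg_odd hp hp4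
  omega

/-! ## THEOREM (Σμ at the Legendre character) -/

/-- the weight (E0) of `tables/DPRIME-THEOREM.md` §6 at `ψ = (·/p)`:
`E_p(x) = 2·(x/3 / p)` for `3 ∣ x`, `(1 − (3/p))·(x / p)` for `3 ∤ x` -/
def E (p x : ℕ) : ℤ := if 3 ∣ x then 2 * J(((x / 3 : ℕ) : ℤ) | p) else (1 - J(3 | p)) * J((x : ℤ) | p)

/-- the canonical (E0) weight `mue` at `ψ = (·/p)` is `E p` -/
lemma mue_leg (p x : ℕ) : mue (leg p) (leg p) x = E p x := by
  unfold mue E leg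
  rw [Nat.cast_ofNat]

/-- **THEOREM (Σμ, Legendre).**  Let `p ≠ 3` be a prime, `p ≡ 3 (mod 4)`, `m = 3p`.  Let `T = (a, b, c)` and
`T′ = (a′, b′, c′)` have zero sums mod `m`, all entries prime to `p`, and the same CM type.  Then
`E_p(a) + E_p(b) + E_p(c) = E_p(a′) + E_p(b′) + E_p(c′)`. -/
theorem E_sum_eq_of_sameType {p : ℕ} (hp : p.Prime) (hp4 : p % 4 = 3) (hp3 : p ≠ 3) {a b c a' b' c' : ℕ}
    (hs : 3 * p ∣ a + b + c) (hs' : 3 * p ∣ a' + b' + c')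
    (ha : Nat.Coprime a p) (hb : Nat.Coprime b p) (hc : Nat.Coprime c p)
    (ha' : Nat.Coprime a' p) (hb' : Nat.Coprime b' p) (hc' : Nat.Coprime c' p)
    (hT : SameType (3 * p) (a, b, c) (a', b', c')) :
    E p a + E p b + E p c = E p a' + E p b' + E p c' := by
  have h1p : 1 < p := hp.one_lt
  have h3p : ¬ 3 ∣ p := fun h => hp3 ((Nat.prime_dvd_prime_iff_eq Nat.prime_three hp).mp h).symm
  have key := mu_identity (leg_isChar p) h1p h3p (fun x hx => leg_mul_self hx) hs hs' ha hb hc ha' hb' hc' hT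
  have hM : mass p (leg p) = 0 :=
    mass_eq_zero_of_odd (leg_isChar p) h1p (leg_neg_one hp4) (fun z hz => by omega)
  simp only [muw_eq (leg_isChar p) h1p h3p (leg_one p), hM, mul_zero, zero_mul, add_zero, mue_leg] at key
  have h3S : (3 : ℤ) * moment p (leg p) ≠ 0 := mul_ne_zero (by norm_num) (moment_leg_ne_zero hp hp4)
  apply mul_left_cancel₀ h3S
  linear_combination key

/-! ## Corollaries at `p ≡ 11 (mod 12)` (`(3/p) = 1`) and `p ≡ 7 (mod 12)` (`(3/p) = −1`) -/

/-- `(3/p) = 1` for `p ≡ 11 (mod 12)` (quadratic reciprocity) -/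
lemma jacobiSym_three_of_mod_twelve_eleven {p : ℕ} (hp12 : p % 12 = 11) : J(3 | p) = 1 := by
  have h := jacobiSym.quadratic_reciprocity_three_mod_four (by norm_num : 3 % 4 = 3) (by omega : p % 4 = 3)
  rw [jacobiSym.mod_left (p : ℤ) 3, show (p : ℤ) % ((3 : ℕ) : ℤ) = 2 by omega] at h
  rw [Nat.cast_ofNat] at h
  rw [h]
  norm_num

/-- `(3/p) = −1` for `p ≡ 7 (mod 12)` (quadratic reciprocity) -/
lemma jacobiSym_three_of_mod_twelve_seven {p : ℕ} (hp12 : p % 12 = 7) : J(3 | p) = -1 := by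
  have h := jacobiSym.quadratic_reciprocity_three_mod_four (by norm_num : 3 % 4 = 3) (by omega : p % 4 = 3)
  rw [jacobiSym.mod_left (p : ℤ) 3, show (p : ℤ) % ((3 : ℕ) : ℤ) = 1 by omega] at h
  rw [Nat.cast_ofNat] at h
  rw [h]
  norm_num

/-- `3y` is prime to `p` when `y` is and `p ≠ 3` -/
lemma coprime_three_mul_of_prime {p y : ℕ} (hp : p.Prime) (hp3 : p ≠ 3) (hy : Nat.Coprime y p) :
    Nat.Coprime (3 * y) p :=
  Nat.Coprime.mul_left ((Nat.coprime_primes Nat.prime_three hp).mpr hp3.symm) hy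

/-- **COROLLARY (the Legendre symbol of the third entry).**  `p ≡ 11 (mod 12)` prime, `m = 3p`: two triples
`(3y, u, v) ∼ (3y′, u′, v′)` of the same CM type with `3 ∤ u, v, u′, v′` (pattern Z1 at 3), zero sums mod `m` and all
of `y, u, v, y′, u′, v′` prime to `p` have `(y/p) = (y′/p)`. -/
theorem legendre_third_eq {p : ℕ} (hp : p.Prime) (hp12 : p % 12 = 11) {y u v y' u' v' : ℕ}
    (hs : 3 * p ∣ 3 * y + u + v) (hs' : 3 * p ∣ 3 * y' + u' + v')
    (hy : Nat.Coprime y p) (hu : Nat.Coprime u p) (hv : Nat.Coprime v p)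
    (hy' : Nat.Coprime y' p) (hu' : Nat.Coprime u' p) (hv' : Nat.Coprime v' p)
    (h3u : ¬ 3 ∣ u) (h3v : ¬ 3 ∣ v) (h3u' : ¬ 3 ∣ u') (h3v' : ¬ 3 ∣ v')
    (hT : SameType (3 * p) (3 * y, u, v) (3 * y', u', v')) :
    J((y : ℤ) | p) = J((y' : ℤ) | p) := by
  have hp3 : p ≠ 3 := by omega
  have key := E_sum_eq_of_sameType hp (by omega) hp3 hs hs' (coprime_three_mul_of_prime hp hp3 hy) hu hv
    (coprime_three_mul_of_prime hp hp3 hy') hu' hv' hT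
  have h3 := jacobiSym_three_of_mod_twelve_eleven hp12
  simp only [E, h3u, h3v, h3u', h3v', if_false, Dvd.intro y rfl, Dvd.intro y' rfl, if_true,
    Nat.mul_div_cancel_left y (by norm_num : 0 < 3), Nat.mul_div_cancel_left y' (by norm_num : 0 < 3), h3,
    sub_self, zero_mul, add_zero] at key
  linarith

/-- **COROLLARY (Z1 ∼ Z3).**  `p ≡ 11 (mod 12)` prime, `m = 3p`: if `(3y, u, v) ∼ (3a′, 3b′, 3c′)` (same CM type, zero
sums, `3 ∤ u, v`, all of `y, u, v, a′, b′, c′` prime to `p`), then `(y/p) = (a′/p) + (b′/p) + (c′/p)`. -/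
theorem legendre_Z1_Z3 {p : ℕ} (hp : p.Prime) (hp12 : p % 12 = 11) {y u v a' b' c' : ℕ}
    (hs : 3 * p ∣ 3 * y + u + v) (hs' : 3 * p ∣ 3 * a' + 3 * b' + 3 * c')
    (hy : Nat.Coprime y p) (hu : Nat.Coprime u p) (hv : Nat.Coprime v p)
    (ha' : Nat.Coprime a' p) (hb' : Nat.Coprime b' p) (hc' : Nat.Coprime c' p)
    (h3u : ¬ 3 ∣ u) (h3v : ¬ 3 ∣ v)
    (hT : SameType (3 * p) (3 * y, u, v) (3 * a', 3 * b', 3 * c')) :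
    J((y : ℤ) | p) = J((a' : ℤ) | p) + J((b' : ℤ) | p) + J((c' : ℤ) | p) := by
  have hp3 : p ≠ 3 := by omega
  have key := E_sum_eq_of_sameType hp (by omega) hp3 hs hs' (coprime_three_mul_of_prime hp hp3 hy) hu hv
    (coprime_three_mul_of_prime hp hp3 ha') (coprime_three_mul_of_prime hp hp3 hb')
    (coprime_three_mul_of_prime hp hp3 hc') hT
  have h3 := jacobiSym_three_of_mod_twelve_eleven hp12
  simp only [E, h3u, h3v, if_false, Dvd.intro y rfl, Dvd.intro a' rfl, Dvd.intro b' rfl, Dvd.intro c' rfl, if_true,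
    Nat.mul_div_cancel_left y (by norm_num : 0 < 3), Nat.mul_div_cancel_left a' (by norm_num : 0 < 3),
    Nat.mul_div_cancel_left b' (by norm_num : 0 < 3), Nat.mul_div_cancel_left c' (by norm_num : 0 < 3), h3,
    sub_self, zero_mul, add_zero] at key
  linarith

/-- the reduced entry: `x/3` if `3 ∣ x`, else `x` -/
def red (x : ℕ) : ℕ := if 3 ∣ x then x / 3 else x

/-- **COROLLARY (total Legendre symbol).**  `p ≡ 7 (mod 12)` prime, `m = 3p` (these are levels where `χ₃ × 1` is BAD:
`p ≡ 1 (mod 3)`): for two triples of the same CM type with zero sums and all entries prime to `p`,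
`Σ_{x ∈ T} (red(x) / p) = Σ_{x ∈ T′} (red(x) / p)`. -/
theorem legendre_total_eq {p : ℕ} (hp : p.Prime) (hp12 : p % 12 = 7) {a b c a' b' c' : ℕ}
    (hs : 3 * p ∣ a + b + c) (hs' : 3 * p ∣ a' + b' + c')
    (ha : Nat.Coprime a p) (hb : Nat.Coprime b p) (hc : Nat.Coprime c p)
    (ha' : Nat.Coprime a' p) (hb' : Nat.Coprime b' p) (hc' : Nat.Coprime c' p)
    (hT : SameType (3 * p) (a, b, c) (a', b', c')) :
    J((red a : ℤ) | p) + J((red b : ℤ) | p) + J((red c : ℤ) | p)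
      = J((red a' : ℤ) | p) + J((red b' : ℤ) | p) + J((red c' : ℤ) | p) := by
  have key := E_sum_eq_of_sameType hp (by omega) (by omega) hs hs' ha hb hc ha' hb' hc' hT
  have h3 := jacobiSym_three_of_mod_twelve_seven hp12
  have hE : ∀ x, E p x = 2 * J((red x : ℤ) | p) := by
    intro x
    unfold E red
    by_cases hx : 3 ∣ x
    · rw [if_pos hx, if_pos hx]
    · rw [if_neg hx, if_neg hx, h3]; ring
  simp only [hE] at key
  linarith

/-! ## Kernel instances (non-vacuity) at `m = 33 = 3·11` and `m = 21 = 3·7` -/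

/-- `(9, 1, 23) ∼ (3, 9, 21)` at `33`: Z1 ∼ Z3, all entries units mod `11` -/
theorem sameType_33a : SameType (3 * 11) (9, 1, 23) (3, 9, 21) := sameType_of_fin (by norm_num) (by decide)

/-- `(30, 1, 2) ∼ (21, 2, 10)` at `33`: Z1 ∼ Z1 -/
theorem sameType_33b : SameType (3 * 11) (30, 1, 2) (21, 2, 10) := sameType_of_fin (by norm_num) (by decide)

/-- `(1, 1, 19) ∼ (1, 3, 17)` at `21`: the exceptional (U, Z1) coincidence of COROLLARY M -/
theorem sameType_21a : SameType (3 * 7) (1, 1, 19) (1, 3, 17) := sameType_of_fin (by norm_num) (by decide)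

/-- COROLLARY (Z1 ∼ Z3) on `(9, 1, 23) ∼ (3, 9, 21)`: `(3/11) = (1/11) + (3/11) + (7/11)`, i.e. `1 = 1 + 1 − 1` -/
example : J(((3 : ℕ) : ℤ) | 11) = J(((1 : ℕ) : ℤ) | 11) + J(((3 : ℕ) : ℤ) | 11) + J(((7 : ℕ) : ℤ) | 11) :=
  legendre_Z1_Z3 (y := 3) (u := 1) (v := 23) (a' := 1) (b' := 3) (c' := 7) (by norm_num) (by norm_num)
    (by norm_num) (by norm_num) (by norm_num) (by norm_num) (by norm_num) (by norm_num) (by norm_num) (by norm_num)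
    (by norm_num) (by norm_num) sameType_33a

/-- COROLLARY (third entry) on `(30, 1, 2) ∼ (21, 2, 10)`: `(10/11) = (7/11)` (`= −1`) -/
example : J(((10 : ℕ) : ℤ) | 11) = J(((7 : ℕ) : ℤ) | 11) :=
  legendre_third_eq (y := 10) (u := 1) (v := 2) (y' := 7) (u' := 2) (v' := 10) (by norm_num) (by norm_num)
    (by norm_num) (by norm_num) (by norm_num) (by norm_num) (by norm_num) (by norm_num) (by norm_num) (by norm_num)
    (by norm_num) (by norm_num) (by norm_num) (by norm_num) sameType_33b

/-- THEOREM (Σμ, Legendre) on the exceptional coincidence `(1, 1, 19) ∼ (1, 3, 17)` at `21` (a BAD level for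
`χ₃ × 1`): both sides equal `2` -/
example : E 7 1 + E 7 1 + E 7 19 = E 7 1 + E 7 3 + E 7 17 :=
  E_sum_eq_of_sameType (by norm_num) (by norm_num) (by norm_num) (by norm_num) (by norm_num)
    (by norm_num) (by norm_num) (by norm_num) (by norm_num) (by norm_num) (by norm_num) sameType_21a

example : E 7 1 + E 7 1 + E 7 19 = 2 ∧ E 7 1 + E 7 3 + E 7 17 = 2 := by norm_num [E]

end HodgeFermat.KRFree.MuLegendre
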